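import Literature.MathematicalPhysics.QuantumLattice.HubbardFreeKineticLowerBound
import Literature.MathematicalPhysics.QuantumLattice.HubbardLangerMattisFourByFour
import Literature.MathematicalPhysics.QuantumLattice.HubbardNNNHoppingRectSymmetries
import Literature.MathematicalPhysics.QuantumLattice.HubbardDoubleOccupancyBounds
import HarnessLib

/-!
# The free-fermion (kinetic) lower bound for the repulsive `t–t'` Hubbard model on the square torus,
# and the double occupancy of its ground states as a supergradient in `U`

Family `hubbard` (trunk T-QLATTICE); written for the certified-numerics cell `pub-hubbard`
(observable brackets at `t' ≠ 0`: the typed `t–t'` energy certificates of the cell live at ONE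
coupling `U = 8`, so the second point of every concavity window must be the EXACTLY SOLVABLE point
`U = 0`, i.e. free fermions with the `t–t'` band).

## Content

* §1 The next-nearest-neighbour (diagonal) hopping matrix of `(ℤ/Lℤ)²`, `L ≥ 3`, is diagonalised by
  the site plane waves with symbol `4t' cos p₁ cos p₂` (`sum_ite_torusDiagGraph_adj_torusChar`,
  `hopMatrix_diag_mul_sitePlaneWave`); hence the `t–t'` hopping matrix
  `-t A_nn - t' A_diag` (`ttHopMatrix`) has the plane-wave levels
  `ε(k) = -2t(cos p₁ + cos p₂) - 4t' cos p₁ cos p₂`, `p = 2πk/L` (`ttBand`,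
  `charpoly_ttHopMatrix`, `sum_eigenvalues_ttHopMatrix`).
* §2 For `U ≥ 0`, every `μ` and every `N ≤ 2L²`:
  `μ N + 2 Σ_k min(ε(k) - μ, 0) ≤ E_N(t, t', U)` on `(ℤ/Lℤ)²`
  (`le_groundEnergy_hubbardTorusTT'`; Lieb–Loss bathtub on each spin species, the tree's
  `FreeKinetic.sum_min_sub_mul_normSq_le`, plus `U Σ n↑n↓ ≥ 0`).
* §3 The `4 × 4` torus at `t = 1`, `-1/2 ≤ t' ≤ 0`: `E_14 ≥ -24 + 8t'` and `E_16 ≥ -24 + 8t'`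
  (closed-form momentum sums; at `U = 0` these are equalities — the Fermi sea — though only the
  inequality is recorded), also transported to the rectangular presentation `hubbardRectTorusTT' 4 4`.
* §4 At fixed `(t, t')` the map `U ↦ E_N(U)` has the double occupancy of a ground state as a
  supergradient (`groundEnergy_tt_sub_le_mul_doubleOcc`), whence one-sided/two-sided brackets on
  `⟨Σ_x n_{x↑}n_{x↓}⟩` and on the full kinetic energy `⟨H(t,t',0)⟩` of a ground state from energy
  bounds at two couplings (`doubleOcc_tt_le_of_bounds`, `re_expect_tt_zero_mem_Icc`) — the `t–t'`
  twin of the tree's `DoubleOccupancy.doubleOcc_mem_Icc_of_bounds`.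

Not here: the equality `E_N(t,t',0) =` Fermi-sea sum (only `≥` is needed downstream); `L ≤ 2`.

## References

* E. H. Lieb, M. Loss, Duke Math. J. 71 (1993) 337, §8 (sum of negative eigenvalues bounds `dΓ`);
  *Analysis* (2nd ed., 2001) Thm 1.14 (bathtub). [LiebLoss1993]
* S. Friedli, Y. Velenik, *Statistical Mechanics of Lattice Systems* (2017), §10.5.2 (plane waves on
  the torus). [FriedliVelenikSMLS2017]
* H. Xu et al., Science 384 (2024) eadh7691, eq. (1) (the `t–t'` Hubbard model, `t' < 0`). [XuEtAl2024]
* T. Koma, H. Tasaki, Commun. Math. Phys. 158 (1993) 191, §1 (`∂E/∂U = ⟨D⟩`, concavity in `U`).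
  [KomaTasaki1994]
* V. Bach, E. H. Lieb, J. P. Solovej, J. Stat. Phys. 76 (1994) 3, eq. (2c.36) (`U Σ n↑n↓ ≥ 0`).
  [BachLiebSolovej1994]
* H. Tasaki, *Physics and Mathematics of Quantum Many-Body Systems* (2020), §2.1 (variational
  principle). [Tasaki2020]
-/

noncomputable section

namespace Literature.MathematicalPhysics.QuantumLattice

namespace TTPrimeFree

open Matrix Finset Polynomial Literature.Probability.LatticeModels
  Literature.MathematicalPhysics.QuantumLattice.RayleighBound LangerMattis FreeKinetic
  ThermodynamicLimit
open scoped ComplexConjugate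

variable {L : ℕ}

/-! ### §1a The diagonal jumps of `(ℤ/Lℤ)²` and the diagonal neighbour sum (`L ≥ 3`) -/

/-- Both diagonal jumps move the first coordinate by `+1`. [folklore] -/
private theorem diagJump_apply_zero (s : Fin 2) : torusDiagJump L s 0 = 1 := by
  simp [torusDiagJump]

/-- `j₀ = e₁ + e₂`. [folklore] -/
private theorem diagJump_zero_eq :
    torusDiagJump L 0 = (Pi.single 0 1 : TorusSite 2 L) + Pi.single 1 1 := by
  funext i
  fin_cases i <;> simp [torusDiagJump]

/-- `j₁ = e₁ - e₂`. [folklore] -/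
private theorem diagJump_one_eq :
    torusDiagJump L 1 = (Pi.single 0 1 : TorusSite 2 L) - Pi.single 1 1 := by
  funext i
  fin_cases i <;> simp [torusDiagJump]

/-- `1 + 1 ≠ 0` in `ℤ/Lℤ` for `L ≥ 3`. [folklore] -/
private theorem one_add_one_ne_zero' (hL : 3 ≤ L) : (1 : ZMod L) + 1 ≠ 0 := by
  intro h
  have : ((2 : ℕ) : ZMod L) = 0 := by exact_mod_cast (by simpa [one_add_one_eq_two] using h)
  rw [ZMod.natCast_eq_zero_iff] at this
  exact absurd (Nat.le_of_dvd two_pos this) (by omega)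

/-- The diagonal jumps are nonzero for `L ≥ 2`. [folklore] -/
private theorem diagJump_ne_zero (hL : 2 ≤ L) (s : Fin 2) : torusDiagJump L s ≠ 0 := by
  haveI : Fact (1 < L) := ⟨by omega⟩
  intro h
  have h0 := congrFun h 0
  rw [diagJump_apply_zero, Pi.zero_apply] at h0
  exact one_ne_zero h0

/-- `e₁ + e₂ ≠ e₁ − e₂` in `(ℤ/L)²` for `L ≥ 3`. [folklore] -/
private theorem diagJump_zero_ne_one (hL : 3 ≤ L) : torusDiagJump L 0 ≠ torusDiagJump L 1 := by
  intro h
  have h1 := congrFun h 1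
  simp only [torusDiagJump, Fin.isValue, if_true, one_ne_zero, if_false] at h1
  exact one_add_one_ne_zero' hL (eq_neg_iff_add_eq_zero.mp h1)

/-- `j_s + j_{s'} ≠ 0` in `(ℤ/L)²` for `L ≥ 3` (first coordinate `1 + 1 ≠ 0`). [folklore] -/
private theorem diagJump_add_ne_zero (hL : 3 ≤ L) (s s' : Fin 2) :
    torusDiagJump L s + torusDiagJump L s' ≠ 0 := by
  intro h
  have h0 := congrFun h 0
  rw [Pi.add_apply, diagJump_apply_zero, diagJump_apply_zero, Pi.zero_apply] at h0
  exact one_add_one_ne_zero' hL h0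

/-- Diagonal adjacency on `(ℤ/L)²`, `L ≥ 2`: `x ∼ y` iff `y = x ± j_s` for some `s`. [folklore] -/
private theorem diagGraph_adj_iff (hL : 2 ≤ L) (x y : TorusSite 2 L) :
    (torusDiagGraph L).Adj x y ↔
      (∃ s, y = x + torusDiagJump L s) ∨ ∃ s, y = x - torusDiagJump L s := by
  rw [torusDiagGraph, SimpleGraph.fromRel_adj]
  constructor
  · rintro ⟨-, h | ⟨s, h⟩⟩
    · exact Or.inl h
    · exact Or.inr ⟨s, by rw [h, add_sub_cancel_right]⟩
  · rintro (⟨s, h⟩ | ⟨s, h⟩)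
    · refine ⟨?_, Or.inl ⟨s, h⟩⟩
      rw [h]
      intro hx
      exact diagJump_ne_zero hL s (by simpa using hx.symm)
    · refine ⟨?_, Or.inr ⟨s, by rw [h, sub_add_cancel]⟩⟩
      rw [h]
      intro hx
      exact diagJump_ne_zero hL s (by simpa [sub_eq_add_neg] using hx)

/-- Diagonal neighbour sum, `L ≥ 3`: over the four *distinct* sites `x ± j_s`. [folklore] -/
private theorem sum_ite_diagGraph_adj [NeZero L] {M : Type*} [AddCommMonoid M] (hL : 3 ≤ L)
    (x : TorusSite 2 L) (g : TorusSite 2 L → M) :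
    (∑ y : TorusSite 2 L, if (torusDiagGraph L).Adj x y then g y else 0) =
      ∑ s, g (x + torusDiagJump L s) + ∑ s, g (x - torusDiagJump L s) := by
  have hL2 : 2 ≤ L := by omega
  have hne : ∀ {a b : TorusSite 2 L}, a ≠ b → x + a ≠ x + b := fun h h' => h (add_left_cancel h')
  have hns : ∀ {a b : TorusSite 2 L}, a + b ≠ 0 → x + a ≠ x - b := fun h h' =>
    h (eq_neg_iff_add_eq_zero.mp (add_left_cancel (h'.trans (sub_eq_add_neg x _))))
  have hss : ∀ {a b : TorusSite 2 L}, a ≠ b → x - a ≠ x - b := fun h h' => h (sub_right_inj.mp h')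
  have h12 := hne (diagJump_zero_ne_one hL)
  have h13 := hns (diagJump_add_ne_zero hL 0 0)
  have h14 := hns (diagJump_add_ne_zero hL 0 1)
  have h23 := hns (diagJump_add_ne_zero hL 1 0)
  have h24 := hns (diagJump_add_ne_zero hL 1 1)
  have h34 := hss (diagJump_zero_ne_one hL)
  have key : ∀ y : TorusSite 2 L,
      (if (torusDiagGraph L).Adj x y then g y else 0) =
        (∑ s, if y = x + torusDiagJump L s then g y else 0) +
          ∑ s, if y = x - torusDiagJump L s then g y else 0 := by
    intro y
    simp only [diagGraph_adj_iff hL2, Fin.exists_fin_two, Fin.sum_univ_two]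
    by_cases ha : y = x + torusDiagJump L 0
    · subst ha
      simp only [h12, h13, h14, or_false, reduceIte, add_zero]
    by_cases hb : y = x + torusDiagJump L 1
    · subst hb
      simp only [h12.symm, h23, h24, or_false, or_true, reduceIte, add_zero, zero_add]
    by_cases hc : y = x - torusDiagJump L 0
    · subst hc
      simp only [h13.symm, h23.symm, h34, or_false, or_true, reduceIte, add_zero, zero_add]
    by_cases hd : y = x - torusDiagJump L 1
    · subst hd
      simp only [h14.symm, h24.symm, h34.symm, or_true, reduceIte, zero_add]
    simp only [ha, hb, hc, hd, or_self, reduceIte, add_zero]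
  simp_rw [key, Finset.sum_add_distrib]
  congr 1
  · rw [Finset.sum_comm]
    simp
  · rw [Finset.sum_comm]
    simp

/-! ### §1b The plane waves diagonalise the diagonal hopping: symbol `4 cos p₁ cos p₂` -/

/-- **The diagonal character sum**: for `L ≥ 3` and `k, x ∈ (ℤ/Lℤ)²`,
`Σ_{y : y ∼_diag x} χ_k(y) = 4 cos p₁ cos p₂ · χ_k(x)`, `p = 2πk/L`
(`χ_k(x ± (e₁ ± e₂))` factor through `χ_k(e₁)`, `χ_k(e₂)` and their conjugates, and
`(a + ā)(b + b̄) = 2cos p₁ · 2cos p₂`). [cite: FriedliVelenikSMLS2017, §10.5.2] -/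
theorem sum_ite_torusDiagGraph_adj_torusChar [NeZero L] (hL : 3 ≤ L) (k x : TorusSite 2 L) :
    (∑ y, if (torusDiagGraph L).Adj x y then torusChar k y else 0) =
      ((4 * Real.cos (latticeMomentum L k 0) * Real.cos (latticeMomentum L k 1) : ℝ) : ℂ) *
        torusChar k x := by
  rw [sum_ite_diagGraph_adj hL, Fin.sum_univ_two, Fin.sum_univ_two, diagJump_zero_eq,
    diagJump_one_eq]
  have ha := torusChar_single_add_conj (by omega : 2 ≤ L) k (0 : Fin 2)
  have hb := torusChar_single_add_conj (by omega : 2 ≤ L) k (1 : Fin 2)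
  simp only [torusChar_add_right, torusChar_sub_right, map_mul, Complex.conj_conj]
  have e : ((4 * Real.cos (latticeMomentum L k 0) * Real.cos (latticeMomentum L k 1) : ℝ) : ℂ) =
      (torusChar k (Pi.single 0 1) + conj (torusChar k (Pi.single 0 1))) *
        (torusChar k (Pi.single 1 1) + conj (torusChar k (Pi.single 1 1))) := by
    rw [ha, hb]
    push_cast
    ring
  rw [e]
  ring

/-- Adjacency of the fermionic diagonal graph is diagonal adjacency of the site images. [folklore] -/
private theorem fermionTorusDiagGraph_adj' (x y : FermionTorus 2 L) :
    (fermionTorusDiagGraph L).Adj x y ↔ (torusDiagGraph L).Adj x.toTorusSite y.toTorusSite :=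
  Iff.rfl

/-- The diagonal (`t' = 1`) band read off a site index used as a momentum, times `t'`:
`t' · 4 cos(2πk₁/L) cos(2πk₂/L)`. [cite: XuEtAl2024, eq. (1)] -/
def siteDiagBand [NeZero L] (t' : ℝ) (k : FermionTorus 2 L) : ℝ :=
  t' * (4 * Real.cos (latticeMomentum L k.toTorusSite 0) * Real.cos (latticeMomentum L k.toTorusSite 1))

/-- **`(t' A_diag) W = W diag(ε_diag)`**: the site plane waves are eigenvectors of the diagonal hopping
matrix with levels `4t' cos p₁ cos p₂` (`L ≥ 3`). [cite: FriedliVelenikSMLS2017, §10.5.2] -/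
theorem hopMatrix_diag_mul_sitePlaneWave [NeZero L] (hL : 3 ≤ L) (t' : ℝ) :
    hopMatrix (fermionTorusDiagGraph L) t' * sitePlaneWave 2 L =
      sitePlaneWave 2 L * diagonal (fun k => ((siteDiagBand t' k : ℝ) : ℂ)) := by
  ext x k
  rw [Matrix.mul_apply, mul_diagonal]
  simp only [hopMatrix, sitePlaneWave, Matrix.of_apply, fermionTorusDiagGraph_adj', ite_mul, zero_mul]
  rw [FermionTorus.sum_eq_sum_torusSite]
  simp only [FermionTorus.toTorusSite_ofTorusSite]
  have h2 : (∑ z : TorusSite 2 L, if (torusDiagGraph L).Adj x.toTorusSite z then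
      (t' : ℂ) * (torusFourierWeight 2 L * torusChar k.toTorusSite z) else 0) =
      (t' : ℂ) * torusFourierWeight 2 L *
        ∑ z, (if (torusDiagGraph L).Adj x.toTorusSite z then torusChar k.toTorusSite z else 0) := by
    rw [Finset.mul_sum]
    refine Finset.sum_congr rfl fun z _ => ?_
    split_ifs <;> ring
  rw [h2, sum_ite_torusDiagGraph_adj_torusChar hL k.toTorusSite x.toTorusSite, siteDiagBand]
  push_cast
  ring

/-! ### §1c The `t–t'` hopping matrix and its spectrum -/

variable (L) in
/-- The one-body `t–t'` hopping matrix of `(ℤ/Lℤ)²`: `-t A_nn - t' A_diag` (so that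
`H(t,t',0) = dΓ_↑ + dΓ_↓` of it, `hubbardTorusTT'_zero_eq_dGammaSpin`). [cite: XuEtAl2024, eq. (1)] -/
def ttHopMatrix (t t' : ℝ) : Matrix (FermionTorus 2 L) (FermionTorus 2 L) ℂ :=
  hopMatrix (fermionTorusGraph 2 L) (-t) + hopMatrix (fermionTorusDiagGraph L) (-t')

/-- The `t–t'` hopping matrix is Hermitian (real symmetric hopping). [cite: XuEtAl2024, eq. (1)] -/
theorem isHermitian_ttHopMatrix (t t' : ℝ) : (ttHopMatrix L t t').IsHermitian :=
  (isHermitian_hopMatrix _ _).add (isHermitian_hopMatrix _ _)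

variable (L) in
/-- The `t–t'` band of `(ℤ/Lℤ)²`: `ε(k) = -2t(cos p₁ + cos p₂) - 4t' cos p₁ cos p₂`, `p = 2πk/L`.
[cite: XuEtAl2024, eq. (1)] -/
def ttBand (t t' : ℝ) (k : TorusSite 2 L) : ℝ :=
  -t * (2 * ∑ i, Real.cos (latticeMomentum L k i)) +
    -t' * (4 * Real.cos (latticeMomentum L k 0) * Real.cos (latticeMomentum L k 1))

/-- **`A_{tt'} W = W diag(ε)`** (`L ≥ 3`). [cite: FriedliVelenikSMLS2017, §10.5.2] -/
theorem ttHopMatrix_mul_sitePlaneWave [NeZero L] (hL : 3 ≤ L) (t t' : ℝ) :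
    ttHopMatrix L t t' * sitePlaneWave 2 L =
      sitePlaneWave 2 L * diagonal (fun k => ((ttBand L t t' k.toTorusSite : ℝ) : ℂ)) := by
  rw [ttHopMatrix, Matrix.add_mul, hopMatrix_mul_sitePlaneWave hL (-t),
    hopMatrix_diag_mul_sitePlaneWave hL (-t'), ← Matrix.mul_add, diagonal_add]
  congr 2
  funext k
  simp only [siteBand, siteDiagBand, ttBand]
  push_cast
  ring

/-- `A_{tt'} = W diag(ε) Wᴴ`. [cite: FriedliVelenikSMLS2017, §10.5.2] -/
theorem ttHopMatrix_eq_conj [NeZero L] (hL : 3 ≤ L) (t t' : ℝ) :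
    ttHopMatrix L t t' =
      sitePlaneWave 2 L * diagonal (fun k => ((ttBand L t t' k.toTorusSite : ℝ) : ℂ)) *
        (sitePlaneWave 2 L)ᴴ := by
  rw [← ttHopMatrix_mul_sitePlaneWave hL t t', Matrix.mul_assoc, sitePlaneWave_mul_conjTranspose,
    Matrix.mul_one]

/-- The characteristic polynomial of the `t–t'` hopping matrix: `χ = ∏_k (X - ε(k))` (plane-wave
diagonalisation). [cite: FriedliVelenikSMLS2017, §10.5.2] -/
theorem charpoly_ttHopMatrix [NeZero L] (hL : 3 ≤ L) (t t' : ℝ) :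
    (ttHopMatrix L t t').charpoly =
      ∏ k : FermionTorus 2 L, (X - C ((ttBand L t t' k.toTorusSite : ℝ) : ℂ)) := by
  rw [ttHopMatrix_eq_conj hL t t',
    Literature.Computability.AlgebraicComplexity.charpoly_conj_of_mul_eq_one _ _ _
      conjTranspose_sitePlaneWave_mul,
    Matrix.charpoly_diagonal]

/-- **Spectral sums of the `t–t'` hopping matrix are momentum sums**: for every `f : ℝ → ℝ` and
`L ≥ 3`, `Σ_i f(λ_i(A_{tt'})) = Σ_{k ∈ (ℤ/Lℤ)²} f(ε(k))`. [cite: FriedliVelenikSMLS2017, §10.5.2] -/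
theorem sum_eigenvalues_ttHopMatrix [NeZero L] (hL : 3 ≤ L) (t t' : ℝ) (f : ℝ → ℝ) :
    ∑ i, f ((isHermitian_ttHopMatrix (L := L) t t').eigenvalues i) =
      ∑ k : TorusSite 2 L, f (ttBand L t t' k) := by
  rw [Literature.Computability.AlgebraicComplexity.sum_eigenvalues_eq_roots_sum _ f,
    charpoly_ttHopMatrix hL t t',
    Literature.Computability.AlgebraicComplexity.roots_prod_X_sub_C_fun, Multiset.map_map,
    ← Finset.sum_eq_multiset_sum, FermionTorus.sum_eq_sum_torusSite]
  refine Finset.sum_congr rfl fun z _ => ?_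
  simp only [Function.comp_apply, RCLike.re_to_complex, Complex.ofReal_re,
    FermionTorus.toTorusSite_ofTorusSite]

/-! ### §2 The free kinetic lower bound for the `t–t'` model (`U ≥ 0`) -/

/-- **The free `t–t'` Hamiltonian is quadratic**: `H(t,t',0) = dΓ_↑(A_{tt'}) + dΓ_↓(A_{tt'})`.
[cite: LiebLoss1993, §8 eq. (8.1)] -/
theorem hubbardTorusTT'_zero_eq_dGammaSpin [NeZero L] (t t' : ℝ) :
    hubbardTorusTT' L t t' 0 =
      dGammaSpin 0 (ttHopMatrix L t t') + dGammaSpin 1 (ttHopMatrix L t t') := by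
  rw [hubbardTorusTT', hamiltonian_eq_add_speciesHamiltonian (fermionTorusGraph 2 L) t 0,
    hamiltonian_eq_add_speciesHamiltonian (fermionTorusDiagGraph L) t' 0,
    speciesHamiltonian_eq, speciesHamiltonian_eq, speciesHamiltonian_eq, speciesHamiltonian_eq,
    ttHopMatrix, dGammaSpin_add, dGammaSpin_add]
  simp only [zero_div, Complex.ofReal_zero, zero_smul, add_zero]
  abel

/-- `H(t,t',U) = H(t,t',U₀) + (U - U₀) D`, `D = Σ_x n_{x↑}n_{x↓}` (the interaction enters linearly in
`U`; Koma–Tasaki's starting point for `∂E/∂U = ⟨D⟩`). [cite: KomaTasaki1994, §1] -/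
theorem hubbardTorusTT'_eq_add_smul [NeZero L] (t t' U₀ U : ℝ) :
    hubbardTorusTT' L t t' U =
      hubbardTorusTT' L t t' U₀ +
        ((U - U₀ : ℝ) : ℂ) • ∑ x : FermionTorus 2 L, numberOp x 0 * numberOp x 1 := by
  rw [hubbardTorusTT', hubbardTorusTT',
    DoubleOccupancy.hamiltonian_eq_add_smul (fermionTorusGraph 2 L) t U₀ U]
  abel

/-- **Free kinetic lower bound on Fock space, `t–t'` model.** For `U ≥ 0`, every `μ` and every Fock
vector `ψ`: `μ Re⟨ψ, Nψ⟩ + 2 (Σ_i min(λ_i(A_{tt'}) - μ, 0)) ‖ψ‖² ≤ Re⟨ψ, H(t,t',U)ψ⟩`.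
[cite: LiebLoss1993, §8, Theorem 8.2] -/
theorem re_rayleigh_hubbardTorusTT'_ge [NeZero L] (t t' : ℝ) {U : ℝ} (hU : 0 ≤ U) (μ : ℝ)
    (ψ : Fock (Orb (FermionTorus 2 L))) :
    μ * (star ψ ⬝ᵥ (totalNumber *ᵥ ψ)).re +
        2 * (∑ i, min ((isHermitian_ttHopMatrix (L := L) t t').eigenvalues i - μ) 0) * normSq ψ ≤
      (star ψ ⬝ᵥ (hubbardTorusTT' L t t' U *ᵥ ψ)).re := by
  have hD := re_rayleigh_interaction_nonneg ψ
  have h0 : (∑ i, min ((isHermitian_ttHopMatrix (L := L) t t').eigenvalues i - μ) 0) * normSq ψ +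
      μ * (star ψ ⬝ᵥ ((∑ x : FermionTorus 2 L, numberOp x 0) *ᵥ ψ)).re ≤
        (star ψ ⬝ᵥ (dGammaSpin 0 (ttHopMatrix L t t') *ᵥ ψ)).re := by
    convert sum_min_sub_mul_normSq_le (σ := 0) (isHermitian_ttHopMatrix (L := L) t t') μ ψ using 10
  have h1 : (∑ i, min ((isHermitian_ttHopMatrix (L := L) t t').eigenvalues i - μ) 0) * normSq ψ +
      μ * (star ψ ⬝ᵥ ((∑ x : FermionTorus 2 L, numberOp x 1) *ᵥ ψ)).re ≤
        (star ψ ⬝ᵥ (dGammaSpin 1 (ttHopMatrix L t t') *ᵥ ψ)).re := by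
    convert sum_min_sub_mul_normSq_le (σ := 1) (isHermitian_ttHopMatrix (L := L) t t') μ ψ using 10
  rw [hubbardTorusTT'_eq_add_smul t t' 0 U, sub_zero, hubbardTorusTT'_zero_eq_dGammaSpin, add_mulVec,
    add_mulVec, dotProduct_add, dotProduct_add, Complex.add_re, Complex.add_re, Matrix.smul_mulVec,
    dotProduct_smul, smul_eq_mul, Complex.re_ofReal_mul, totalNumber_eq_add, add_mulVec,
    dotProduct_add, Complex.add_re]
  have hU2 : 0 ≤ U * (star ψ ⬝ᵥ ((∑ x : FermionTorus 2 L, numberOp x 0 * numberOp x 1) *ᵥ ψ)).re :=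
    mul_nonneg hU hD
  linarith

/-- **Free kinetic lower bound for the `t–t'` Hubbard ground-state energy on `(ℤ/Lℤ)²`.** For
`U ≥ 0`, every `μ` and every `N ≤ 2L²`:
`μ N + 2 Σ_i min(λ_i(A_{tt'}) - μ, 0) ≤ E_N(t,t',U)` (no ground state is needed: the bound holds
for every unit `N`-particle vector). [cite: LiebLoss1993, §8, Theorem 8.2] -/
theorem le_groundEnergy_hubbardTorusTT'_eig [NeZero L] (t t' : ℝ) {U : ℝ} (hU : 0 ≤ U) (μ : ℝ)
    {N : ℕ} (hN : N ≤ 2 * L ^ 2) :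
    μ * N + 2 * ∑ i, min ((isHermitian_ttHopMatrix (L := L) t t').eigenvalues i - μ) 0 ≤
      groundEnergy (hubbardTorusTT' L t t' U) N := by
  have hcard : N ≤ Fintype.card (Orb (FermionTorus 2 L)) := by
    rw [card_orb, card_fermionTorus_eq]; exact hN
  unfold groundEnergy
  refine le_csInf (groundEnergySet_nonempty _ hcard) ?_
  rintro E ⟨ψ, hψN, hψ1, rfl⟩
  have hnorm : normSq ψ = 1 := by
    have h := star_dotProduct_self_eq_normSq ψ
    rw [hψ1] at h
    exact_mod_cast h.symm
  have hNum : (star ψ ⬝ᵥ (totalNumber *ᵥ ψ)).re = N := by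
    rw [LangerMattis.totalNumber_mulVec_of_isNParticle hψN, dotProduct_smul, hψ1, smul_eq_mul,
      mul_one, Complex.natCast_re]
  have h := re_rayleigh_hubbardTorusTT'_ge t t' hU μ ψ
  rw [hNum, hnorm, mul_one] at h
  exact h

/-- **Free kinetic lower bound, momentum form** (`L ≥ 3`): for `U ≥ 0`, every `μ`, `N ≤ 2L²`,
`μ N + 2 Σ_{k ∈ (ℤ/Lℤ)²} min(ε(k) - μ, 0) ≤ E_N(t,t',U)`,
`ε(k) = -2t(cos p₁ + cos p₂) - 4t' cos p₁ cos p₂`. Optimising over `μ` gives the Fermi-sea energy.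
[cite: LiebLoss1993, §8, Theorem 8.2][cite: FriedliVelenikSMLS2017, §10.5.2] -/
theorem le_groundEnergy_hubbardTorusTT' [NeZero L] (hL : 3 ≤ L) (t t' : ℝ) {U : ℝ} (hU : 0 ≤ U)
    (μ : ℝ) {N : ℕ} (hN : N ≤ 2 * L ^ 2) :
    μ * N + 2 * ∑ k : TorusSite 2 L, min (ttBand L t t' k - μ) 0 ≤
      groundEnergy (hubbardTorusTT' L t t' U) N := by
  have h := le_groundEnergy_hubbardTorusTT'_eig t t' hU μ hN
  rw [sum_eigenvalues_ttHopMatrix hL t t' (fun x => min (x - μ) 0)] at h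
  exact h

/-! ### §3 The `4 × 4` torus, `t = 1`, `-1/2 ≤ t' ≤ 0`: `E_14, E_16 ≥ -24 + 8t'` -/

/-- The `t–t'` band on `(ℤ/4)²` in closed form (`cos(πm/2) ∈ {1,0,-1,0}`): the sixteen plane-wave
levels of the `4 × 4` torus. [cite: FriedliVelenikSMLS2017, §10.5.2] -/
theorem ttBand_four (t t' : ℝ) (k : TorusSite 2 4) :
    ttBand 4 t t' k = -t * (2 * (cosFour (k 0).val + cosFour (k 1).val)) +
      -t' * (4 * cosFour (k 0).val * cosFour (k 1).val) := by
  simp only [ttBand, Fin.sum_univ_two, cos_latticeMomentum_four]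

/-- **The `N = 14` momentum sum in closed form** (`μ = 4t'`, `-1/2 ≤ t' ≤ 0`): the fourteen lowest
levels are `-4-4t'` (×2), `-2` (×8), `4t'` (×4), so
`4t'·14 + 2 Σ_k min(ε(k) - 4t', 0) = -24 + 8t'` (the Fermi-sea sum of Lieb–Loss' bound at the optimal
`μ`). [cite: LiebLoss1993, §8, Theorem 8.2] -/
theorem ttMomentumSum_four_N14 (t' : ℝ) (h1 : -1 / 2 ≤ t') (h0 : t' ≤ 0) :
    4 * t' * ((14 : ℕ) : ℝ) + 2 * ∑ k : TorusSite 2 4, min (ttBand 4 1 t' k - 4 * t') 0 =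
      -24 + 8 * t' := by
  set F : ℝ → ℝ → ℝ := fun a b => min (-1 * (2 * (a + b)) + -t' * (4 * a * b) - 4 * t') 0 with hF
  have hs : ∑ k : TorusSite 2 4, min (ttBand 4 1 t' k - 4 * t') 0 =
      ∑ ab : Fin 4 × Fin 4, F (cosFour ab.1.val) (cosFour ab.2.val) := by
    refine Fintype.sum_equiv (piFinTwoEquiv fun _ => ZMod 4) _ _ fun k => ?_
    rw [ttBand_four]
    rfl
  have e11 : F 1 1 = -4 - 8 * t' := by simp only [hF]; rw [min_eq_left (by linarith)]; ring
  have e10 : F 1 0 = -2 - 4 * t' := by simp only [hF]; rw [min_eq_left (by linarith)]; ring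
  have e01 : F 0 1 = -2 - 4 * t' := by simp only [hF]; rw [min_eq_left (by linarith)]; ring
  have e1m : F 1 (-1) = 0 := by simp only [hF]; rw [min_eq_right (by linarith)]
  have em1 : F (-1) 1 = 0 := by simp only [hF]; rw [min_eq_right (by linarith)]
  have e00 : F 0 0 = 0 := by simp only [hF]; rw [min_eq_right (by linarith)]
  have e0m : F 0 (-1) = 0 := by simp only [hF]; rw [min_eq_right (by linarith)]
  have em0 : F (-1) 0 = 0 := by simp only [hF]; rw [min_eq_right (by linarith)]
  have emm : F (-1) (-1) = 0 := by simp only [hF]; rw [min_eq_right (by linarith)]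
  have hv : (0 : Fin 4).val = 0 ∧ (1 : Fin 4).val = 1 ∧ (2 : Fin 4).val = 2 ∧ (3 : Fin 4).val = 3 :=
    ⟨rfl, rfl, rfl, rfl⟩
  have hc : cosFour 0 = 1 ∧ cosFour 1 = 0 ∧ cosFour 2 = -1 ∧ cosFour 3 = 0 := ⟨rfl, rfl, rfl, rfl⟩
  rw [hs, Fintype.sum_prod_type]
  simp only [Fin.sum_univ_four, hv.1, hv.2.1, hv.2.2.1, hv.2.2.2, hc.1, hc.2.1, hc.2.2.1, hc.2.2.2]
  rw [e11, e10, e01, e1m, em1, e00, e0m, em0, emm]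
  push_cast
  ring

/-- **The `N = 16` momentum sum in closed form** (`μ = 0`, `-1 ≤ t' ≤ 0`): the negative levels are
`-4-4t'` (×2), `-2` (×8), `4t'` (×4), so `2 Σ_k min(ε(k), 0) = -24 + 8t'` (the Fermi-sea sum of
Lieb–Loss' bound at `μ = 0`). [cite: LiebLoss1993, §8, Theorem 8.2] -/
theorem ttMomentumSum_four_N16 (t' : ℝ) (h1 : -1 ≤ t') (h0 : t' ≤ 0) :
    0 * ((16 : ℕ) : ℝ) + 2 * ∑ k : TorusSite 2 4, min (ttBand 4 1 t' k - 0) 0 = -24 + 8 * t' := by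
  set F : ℝ → ℝ → ℝ := fun a b => min (-1 * (2 * (a + b)) + -t' * (4 * a * b) - 0) 0 with hF
  have hs : ∑ k : TorusSite 2 4, min (ttBand 4 1 t' k - 0) 0 =
      ∑ ab : Fin 4 × Fin 4, F (cosFour ab.1.val) (cosFour ab.2.val) := by
    refine Fintype.sum_equiv (piFinTwoEquiv fun _ => ZMod 4) _ _ fun k => ?_
    rw [ttBand_four]
    rfl
  have e11 : F 1 1 = -4 - 4 * t' := by simp only [hF]; rw [min_eq_left (by linarith)]; ring
  have e10 : F 1 0 = -2 := by simp only [hF]; rw [min_eq_left (by linarith)]; ring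
  have e01 : F 0 1 = -2 := by simp only [hF]; rw [min_eq_left (by linarith)]; ring
  have e1m : F 1 (-1) = 4 * t' := by simp only [hF]; rw [min_eq_left (by linarith)]; ring
  have em1 : F (-1) 1 = 4 * t' := by simp only [hF]; rw [min_eq_left (by linarith)]; ring
  have e00 : F 0 0 = 0 := by simp only [hF]; rw [min_eq_right (by linarith)]
  have e0m : F 0 (-1) = 0 := by simp only [hF]; rw [min_eq_right (by linarith)]
  have em0 : F (-1) 0 = 0 := by simp only [hF]; rw [min_eq_right (by linarith)]
  have emm : F (-1) (-1) = 0 := by simp only [hF]; rw [min_eq_right (by linarith)]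
  have hv : (0 : Fin 4).val = 0 ∧ (1 : Fin 4).val = 1 ∧ (2 : Fin 4).val = 2 ∧ (3 : Fin 4).val = 3 :=
    ⟨rfl, rfl, rfl, rfl⟩
  have hc : cosFour 0 = 1 ∧ cosFour 1 = 0 ∧ cosFour 2 = -1 ∧ cosFour 3 = 0 := ⟨rfl, rfl, rfl, rfl⟩
  rw [hs, Fintype.sum_prod_type]
  simp only [Fin.sum_univ_four, hv.1, hv.2.1, hv.2.2.1, hv.2.2.2, hc.1, hc.2.1, hc.2.2.1, hc.2.2.2]
  rw [e11, e10, e01, e1m, em1, e00, e0m, em0, emm]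
  push_cast
  ring

/-- **Free-fermion floor, `4 × 4` torus, `N = 14` (filling 7/8), `t = 1`, `-1/2 ≤ t' ≤ 0`, `U ≥ 0`:
`E_14(1,t',U) ≥ -24 + 8t'`** (at `U = 0` this is the exact Fermi-sea value). [cite: LiebLoss1993, §8, Theorem 8.2] -/
theorem groundEnergy_hubbardTorusTT'_four_N14_ge (t' : ℝ) (h1 : -1 / 2 ≤ t') (h0 : t' ≤ 0) {U : ℝ}
    (hU : 0 ≤ U) : -24 + 8 * t' ≤ groundEnergy (hubbardTorusTT' 4 1 t' U) 14 := by
  haveI : NeZero (4 : ℕ) := ⟨by norm_num⟩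
  have h := le_groundEnergy_hubbardTorusTT' (L := 4) (by norm_num) 1 t' hU (4 * t') (N := 14)
    (by norm_num)
  rw [ttMomentumSum_four_N14 t' h1 h0] at h
  exact h

/-- **Free-fermion floor, `4 × 4` torus, `N = 16` (half filling), `t = 1`, `-1 ≤ t' ≤ 0`, `U ≥ 0`:
`E_16(1,t',U) ≥ -24 + 8t'`**. [cite: LiebLoss1993, §8, Theorem 8.2] -/
theorem groundEnergy_hubbardTorusTT'_four_N16_ge (t' : ℝ) (h1 : -1 ≤ t') (h0 : t' ≤ 0) {U : ℝ}
    (hU : 0 ≤ U) : -24 + 8 * t' ≤ groundEnergy (hubbardTorusTT' 4 1 t' U) 16 := by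
  haveI : NeZero (4 : ℕ) := ⟨by norm_num⟩
  have h := le_groundEnergy_hubbardTorusTT' (L := 4) (by norm_num) 1 t' hU 0 (N := 16)
    (by norm_num)
  rw [ttMomentumSum_four_N16 t' h1 h0] at h
  exact h

/-- The same floors in the rectangular presentation `hubbardRectTorusTT' 4 4` (the cell's typed
`t–t'` certificates are stated there; `groundEnergy_hubbardTorusTT'_eq_rect`). [cite: LiebLoss1993, §8, Theorem 8.2] -/
theorem groundEnergy_hubbardRectTorusTT'_four_N14_ge (t' : ℝ) (h1 : -1 / 2 ≤ t') (h0 : t' ≤ 0)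
    {U : ℝ} (hU : 0 ≤ U) : -24 + 8 * t' ≤ groundEnergy (hubbardRectTorusTT' 4 4 1 t' U) 14 := by
  rw [← groundEnergy_hubbardTorusTT'_eq_rect]
  exact groundEnergy_hubbardTorusTT'_four_N14_ge t' h1 h0 hU

/-- Rectangular presentation, `N = 16`. [cite: LiebLoss1993, §8, Theorem 8.2] -/
theorem groundEnergy_hubbardRectTorusTT'_four_N16_ge (t' : ℝ) (h1 : -1 ≤ t') (h0 : t' ≤ 0)
    {U : ℝ} (hU : 0 ≤ U) : -24 + 8 * t' ≤ groundEnergy (hubbardRectTorusTT' 4 4 1 t' U) 16 := by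
  rw [← groundEnergy_hubbardTorusTT'_eq_rect]
  exact groundEnergy_hubbardTorusTT'_four_N16_ge t' h1 h0 hU

/-! ### §4 Double occupancy and kinetic energy of `t–t'` ground states from energy bounds -/

section DoubleOcc

variable [NeZero L] (t t' : ℝ)

/-- `Re⟨ψ, H(t,t',U')ψ⟩ = Re⟨ψ, H(t,t',U)ψ⟩ + (U' - U) Re⟨ψ, Dψ⟩` (the energy is affine in `U` on every
state). [cite: KomaTasaki1994, §1] -/
theorem re_expect_hubbardTorusTT'_eq (U U' : ℝ) (ψ : Fock (Orb (FermionTorus 2 L))) :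
    (expect (hubbardTorusTT' L t t' U') ψ).re =
      (expect (hubbardTorusTT' L t t' U) ψ).re +
        (U' - U) * (expect (∑ x : FermionTorus 2 L, numberOp x 0 * numberOp x 1) ψ).re := by
  have hadd : ∀ A B : Matrix (Finset (Orb (FermionTorus 2 L))) (Finset (Orb (FermionTorus 2 L))) ℂ,
      expect (A + B) ψ = expect A ψ + expect B ψ := fun A B => by
    simp [expect, add_mulVec, dotProduct_add]
  have hsmul : ∀ (c : ℂ) (A : Matrix (Finset (Orb (FermionTorus 2 L))) (Finset (Orb (FermionTorus 2 L))) ℂ),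
      expect (c • A) ψ = c * expect A ψ := fun c A => by
    simp [expect, smul_mulVec, dotProduct_smul]
  rw [hubbardTorusTT'_eq_add_smul t t' U U', hadd, hsmul, Complex.add_re, Complex.re_ofReal_mul]

omit [NeZero L] in
/-- The energy of a normalised ground state is `E_N` (variational characterisation of the sector ground
energy). [cite: Tasaki2020, §2.1] -/
theorem re_expect_of_isGroundState_tt (U : ℝ) {N : ℕ} {ψ : Fock (Orb (FermionTorus 2 L))}
    (hψ : IsGroundState (hubbardTorusTT' L t t' U) N ψ) (hψ1 : star ψ ⬝ᵥ ψ = 1) :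
    (expect (hubbardTorusTT' L t t' U) ψ).re = groundEnergy (hubbardTorusTT' L t t' U) N := by
  rw [expect, hψ.2.2, dotProduct_smul, hψ1, smul_eq_mul, mul_one, Complex.ofReal_re]

/-- **The double occupancy of a `t–t'` ground state is a supergradient of `U ↦ E_N(t,t',U)`**:
`E_N(U') - E_N(U) ≤ (U' - U)⟨ψ, Σ_x n_{x↑}n_{x↓} ψ⟩`. [cite: KomaTasaki1994, §1] -/
theorem groundEnergy_tt_sub_le_mul_doubleOcc (U U' : ℝ) {N : ℕ} {ψ : Fock (Orb (FermionTorus 2 L))}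
    (hψ : IsGroundState (hubbardTorusTT' L t t' U) N ψ) (hψ1 : star ψ ⬝ᵥ ψ = 1) :
    groundEnergy (hubbardTorusTT' L t t' U') N - groundEnergy (hubbardTorusTT' L t t' U) N ≤
      (U' - U) * (expect (∑ x : FermionTorus 2 L, numberOp x 0 * numberOp x 1) ψ).re := by
  have h := LiebThm1.groundEnergy_le_re_expect (hubbardTorusTT' L t t' U') hψ.1 hψ1
  rw [re_expect_hubbardTorusTT'_eq t t' U U', re_expect_of_isGroundState_tt t t' U hψ hψ1] at h
  linarith

/-- **One-sided certified bracket**: if `U₁ < U`, `L₁ ≤ E_N(U₁)` and `E_N(U) ≤ R`, every normalised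
ground state `ψ` of `H(t,t',U)` has `⟨D⟩_ψ ≤ (R - L₁)/(U - U₁)` (concavity of `U ↦ E_N(U)`, secant
above the supergradient). [cite: KomaTasaki1994, §1] -/
theorem doubleOcc_tt_le_of_bounds (U : ℝ) {N : ℕ} {ψ : Fock (Orb (FermionTorus 2 L))}
    (hψ : IsGroundState (hubbardTorusTT' L t t' U) N ψ) (hψ1 : star ψ ⬝ᵥ ψ = 1)
    {U₁ L₁ R : ℝ} (hU₁ : U₁ < U) (hL₁ : L₁ ≤ groundEnergy (hubbardTorusTT' L t t' U₁) N)
    (hR : groundEnergy (hubbardTorusTT' L t t' U) N ≤ R) :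
    (expect (∑ x : FermionTorus 2 L, numberOp x 0 * numberOp x 1) ψ).re ≤ (R - L₁) / (U - U₁) := by
  have h2 := groundEnergy_tt_sub_le_mul_doubleOcc t t' U U₁ hψ hψ1
  have hd₁ : 0 < U - U₁ := sub_pos.2 hU₁
  rw [le_div_iff₀ hd₁, mul_comm]
  nlinarith

/-- **Two-sided certified bracket**: if `U₁ < U < U₂`, `L₁ ≤ E_N(U₁)`, `E_N(U) ≤ R`, `L₂ ≤ E_N(U₂)`,
then `(L₂ - R)/(U₂ - U) ≤ ⟨D⟩_ψ ≤ (R - L₁)/(U - U₁)`. [cite: KomaTasaki1994, §1] -/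
theorem doubleOcc_tt_mem_Icc_of_bounds (U : ℝ) {N : ℕ} {ψ : Fock (Orb (FermionTorus 2 L))}
    (hψ : IsGroundState (hubbardTorusTT' L t t' U) N ψ) (hψ1 : star ψ ⬝ᵥ ψ = 1)
    {U₁ U₂ L₁ R L₂ : ℝ} (hU₁ : U₁ < U) (hU₂ : U < U₂)
    (hL₁ : L₁ ≤ groundEnergy (hubbardTorusTT' L t t' U₁) N)
    (hR : groundEnergy (hubbardTorusTT' L t t' U) N ≤ R)
    (hL₂ : L₂ ≤ groundEnergy (hubbardTorusTT' L t t' U₂) N) :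
    (expect (∑ x : FermionTorus 2 L, numberOp x 0 * numberOp x 1) ψ).re ∈
      Set.Icc ((L₂ - R) / (U₂ - U)) ((R - L₁) / (U - U₁)) := by
  have h1 := groundEnergy_tt_sub_le_mul_doubleOcc t t' U U₂ hψ hψ1
  have hd₂ : 0 < U₂ - U := sub_pos.2 hU₂
  refine ⟨?_, doubleOcc_tt_le_of_bounds t t' U hψ hψ1 hU₁ hL₁ hR⟩
  rw [div_le_iff₀ hd₂, mul_comm]
  linarith

/-- **The full kinetic energy of a ground state** (nearest + next-nearest hopping):
`Re⟨ψ, H(t,t',0)ψ⟩ = E_N(U) - U⟨D⟩_ψ` (Hellmann–Feynman bookkeeping `E = K + U⟨D⟩`). [cite: KomaTasaki1994, §1] -/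
theorem re_expect_tt_zero_eq (U : ℝ) {N : ℕ} {ψ : Fock (Orb (FermionTorus 2 L))}
    (hψ : IsGroundState (hubbardTorusTT' L t t' U) N ψ) (hψ1 : star ψ ⬝ᵥ ψ = 1) :
    (expect (hubbardTorusTT' L t t' 0) ψ).re =
      groundEnergy (hubbardTorusTT' L t t' U) N -
        U * (expect (∑ x : FermionTorus 2 L, numberOp x 0 * numberOp x 1) ψ).re := by
  have h := re_expect_hubbardTorusTT'_eq (L := L) t t' U 0 ψ
  rw [re_expect_of_isGroundState_tt t t' U hψ hψ1] at h
  linarith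

/-- **Kinetic bracket from energy bounds** (`U ≥ 0`): if `L₀ ≤ E_N(t,t',0)` and `E_N(t,t',U) ≤ R`,
the full kinetic energy of every normalised ground state of `H(t,t',U)` lies in `[L₀, R]`
(below: the variational principle at `U = 0`; above: `⟨D⟩ ≥ 0`). [cite: Tasaki2020, §2.1] -/
theorem re_expect_tt_zero_mem_Icc {U : ℝ} (hU : 0 ≤ U) {N : ℕ} {ψ : Fock (Orb (FermionTorus 2 L))}
    (hψ : IsGroundState (hubbardTorusTT' L t t' U) N ψ) (hψ1 : star ψ ⬝ᵥ ψ = 1) {L₀ R : ℝ}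
    (hL₀ : L₀ ≤ groundEnergy (hubbardTorusTT' L t t' 0) N)
    (hR : groundEnergy (hubbardTorusTT' L t t' U) N ≤ R) :
    (expect (hubbardTorusTT' L t t' 0) ψ).re ∈ Set.Icc L₀ R := by
  have hvar := LiebThm1.groundEnergy_le_re_expect (hubbardTorusTT' L t t' 0) hψ.1 hψ1
  have hD : 0 ≤ (expect (∑ x : FermionTorus 2 L, numberOp x 0 * numberOp x 1) ψ).re :=
    re_rayleigh_interaction_nonneg ψ
  rw [re_expect_tt_zero_eq t t' U hψ hψ1]
  refine ⟨?_, ?_⟩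
  · rw [← re_expect_tt_zero_eq t t' U hψ hψ1]
    exact le_trans hL₀ hvar
  · nlinarith

end DoubleOcc

end TTPrimeFree

end Literature.MathematicalPhysics.QuantumLattice
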